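import Summits.BirchSwinnertonDyer.BirchSwinnertonDyer.Theorems.ByReductionTypeAtTwoSupersingularIwasawaTwistDualPair
import Literature.NumberTheory.EllipticCurves.IwasawaEulerCharRankZeroProofs
import Literature.NumberTheory.EllipticCurves.IwasawaAlgebraGenericTwistFiniteProofs
import HarnessLib

/-!
# Route `ByReductionTypeAtTwo` (rung K4), crux `SupersingularRankZeroAtTwo` (item stmt-BirchSwinnertonDyer-19097):
# twisted coinvariants of a dual pair VANISH when `X` has no non-zero finite `Λ`-submodule — the Kim / Greenberg
# shape of K67-NF as pure algebra over the tree's axiomatic dual pairs, ANY `p`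
# (seat `bsd-2adic-tower-1`, GEN 57, key «K67-NF KERNEL REDUCTION»; `--supports 19097`, helper; the ♭ specialisation
# at `p = 2`, `n = 2` is the sequel `ByReductionTypeAtTwoSupersingularFlatBlindNoCotorsion`)

HONEST FRAMING (cell `bsd-2adic`, run/shared/lean/pub/bsd-2adic/): THEOREMS ONLY — elementary `Λ = ℤ_p⟦T⟧`-module
algebra over the tree's axiomatic Pontryagin dual pairs (`IwasawaDual.IsDualPair p ψ toDual`) and ss-1's twisted
module `IwasawaTranslation.Twisted` (GEN 17, p797323); no definition, no instance, no named fact, no `sorry`;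
nothing about any curve or Selmer group; nothing booked; BSD is not proved by any of this.  PARTITION (D-0054):
X5@2 good-ss r₀ block × p = 2 — types-the-object-of (the algebra under slot 4 of `Lines/odd_blind_package.lean`);
closes none.  bears_on: K4 (route-BirchSwinnertonDyer-ByReductionTypeAtTwo item 19097).

## What is proved

For a dual pair `(X, S, ψ, toDual)` (`T ↔ ψ = conj_γ − 1`) and a natural number `n` with `p ∣ n` (so that
`T + n ∈ 𝔪_Λ` and `(X^{τ_n}, S, ψ + n)` is again a dual pair, `isDualPair_twisted`):

* §1 transport: the `T`-torsion `X^{τ_n}[T]` of the twisted module IS `X[T + n]`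
  (`toTwisted_mem_invariants_iff`, `natCard_invariants_twisted`, `invariants_twisted_eq_bot_iff`);
* §2 the dictionary `#X[T + n] = #S/(ψ + n)S` (`natCard_torsionBy_X_add_C_eq`); Greenberg's Lemma 4.2 (i) at the
  twist: `X` f.g. torsion and `S[ψ + n]` finite ⇒ `S/(ψ + n)S` and `X[T + n]` finite
  (`finite_endCoinvariants_add_natCast_of_finite`, `finite_torsionBy_X_add_C_of_finite`);
* §3 ★ **`subsingleton_endCoinvariants_add_natCast_of_forall_finite_eq_bot`**: if moreover `X` has NO non-zero
  finite `Λ`-submodule then `S/(ψ + n)S = 0` (`X[T + n]` is a finite submodule, hence `⊥`, hence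
  `#S/(ψ + n)S = 1`) — Greenberg, LNM 1716 p. 124 ("since … has no proper `Λ`-submodules of finite index … for
  suitably chosen `s`, `H¹(F_Σ/F_∞, M)_Γ = 0`"), B. D. Kim 2013 Thm. 3.14 ⇒ Cor. for `±` at odd `p` (shape);
* §4 the converse, hypothesis-free: `S/(ψ + n)S = 0` ⇒ `X[T + n] = ⊥` ⇒ `X` has no non-zero finite
  `Λ`-submodule (`T + n ∈ 𝔪_Λ`; tree `forall_finite_eq_bot_of_torsionBy_eq_bot`, Greenberg p. 117 / proof of
  Prop. 4.14 p. 105); so, GIVEN `S[ψ + n]` finite, «no finite submodule» ⟺ «twisted coinvariants trivial»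
  (`forall_finite_eq_bot_iff_subsingleton_endCoinvariants_add_natCast`).

At `p = 2`, `n = 2`, `ψ = conj_γ − 1` on Sprung's `Sel♭(E/ℚ_∞)`: `ψ + 2 = conj_γ + 1` is the blind (order-2)
character and §3 is K67-NF ⟸ NF♭ (sequel file).  The surjective-form converse for `ψ − c` is the route-free
`Theorems/IwasawaTwistedCoinvariantsNoFiniteSubmodule.lean` (cell bsd-potss); this file is its `ψ + n` reading
through the twisted module, plus the forward direction.

References: R. Greenberg, LNM 1716 (1999), §4 Lemma 4.2, pp. 105, 117, 124 [cite: GreenbergLNM1716, §4 Lemma 4.2];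
B. D. Kim, J. Aust. Math. Soc. 95 (2013) 189–200, Thm. 3.14 (shape only, odd p) [cite: BDKim2013, Thm. 3.14];
T. Kitajima, R. Otsuki, Tokyo J. Math. 41 (2018), Thm. 1.3 / Lemma 3.30 (shape only, odd p).
-/

set_option autoImplicit false
-- the Theorems namespace of this sub repeats the summit name by design (D-0017 nested layout)
set_option linter.dupNamespace false

noncomputable section

namespace Summit.BirchSwinnertonDyer.BirchSwinnertonDyer.Theorems

namespace IwasawaTranslation

open Literature.NumberTheory.EllipticCurves Literature.NumberTheory.EllipticCurves.IwasawaDual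
  Literature.NumberTheory.EllipticCurves.IwasawaAlgebra

universe u

variable {p : ℕ} [Fact p.Prime]

/-! ### §1 Transport: `X^{τ_t}[T] = X[T + t]` -/

section Transport

variable {t : ℤ_[p]} (ht : ‖t‖ < 1) {X : Type u} [AddCommGroup X] [Module (IwasawaAlgebra p) X]

/-- **`x̃ ∈ X^{τ_t}[T] ↔ x ∈ X[T + t]`**: `T` acts on the twisted module as `T + t` (`X_smul_toTwisted`).
[folklore] -/
theorem toTwisted_mem_invariants_iff (x : X) :
    toTwisted ht x ∈ invariants p (Twisted ht X) ↔
      x ∈ Submodule.torsionBy (IwasawaAlgebra p) X (PowerSeries.X + PowerSeries.C t) := by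
  rw [Submodule.mem_torsionBy_iff, Submodule.mem_torsionBy_iff, X_smul_toTwisted,
    EmbeddingLike.map_eq_zero_iff]

/-- **`#X^{τ_t}[T] = #X[T + t]`** (the same subgroup of the same additive group). [folklore] -/
theorem natCard_invariants_twisted :
    Nat.card (invariants p (Twisted ht X)) =
      Nat.card (Submodule.torsionBy (IwasawaAlgebra p) X (PowerSeries.X + PowerSeries.C t)) :=
  (Nat.card_congr
    ((toTwisted ht).toEquiv.subtypeEquiv fun x => (toTwisted_mem_invariants_iff ht x).symm)).symm

/-- `X^{τ_t}[T]` is finite iff `X[T + t]` is. [folklore] -/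
theorem finite_invariants_twisted_iff :
    Finite (invariants p (Twisted ht X)) ↔
      Finite (Submodule.torsionBy (IwasawaAlgebra p) X (PowerSeries.X + PowerSeries.C t)) :=
  Equiv.finite_iff
    ((toTwisted ht).toEquiv.subtypeEquiv fun x => (toTwisted_mem_invariants_iff ht x).symm).symm

/-- `X^{τ_t}[T] = 0 ↔ X[T + t] = 0`. [folklore] -/
theorem invariants_twisted_eq_bot_iff :
    invariants p (Twisted ht X) = ⊥ ↔
      Submodule.torsionBy (IwasawaAlgebra p) X (PowerSeries.X + PowerSeries.C t) = ⊥ := by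
  simp only [Submodule.eq_bot_iff]
  constructor
  · intro h x hx
    exact (EmbeddingLike.map_eq_zero_iff (f := toTwisted ht)).mp
      (h (toTwisted ht x) ((toTwisted_mem_invariants_iff ht x).mpr hx))
  · intro h y hy
    obtain ⟨x, rfl⟩ := toTwisted_surjective ht y
    rw [h x ((toTwisted_mem_invariants_iff ht x).mp hy), map_zero]

end Transport

/-- `T + t ∈ 𝔪_Λ` for `‖t‖ < 1` (its constant term `t` is a non-unit of `ℤ_p`). [folklore] -/
theorem X_add_C_mem_maximalIdeal {t : ℤ_[p]} (ht : ‖t‖ < 1) :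
    (PowerSeries.X + PowerSeries.C t : IwasawaAlgebra p) ∈ IsLocalRing.maximalIdeal (IwasawaAlgebra p) := by
  rw [IsLocalRing.mem_maximalIdeal, mem_nonunits_iff, PowerSeries.isUnit_iff_constantCoeff]
  simp only [map_add, PowerSeries.constantCoeff_X, PowerSeries.constantCoeff_C, zero_add, PadicInt.isUnit_iff]
  exact ht.ne

/-! ### §2 The dictionary at the twist and Lemma 4.2 (i) -/

section DualPair

variable {S : Type*} [AddCommGroup S] {ψ : AddMonoid.End S}
variable {X : Type u} [AddCommGroup X] [Module (IwasawaAlgebra p) X]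
variable {toDual : X →+ (S →+ AddCircle (1 : ℚ))}

/-- **`#X[T + n] = #S/(ψ + n)S`** for a dual pair and `p ∣ n`: the invariants side of Greenberg's dictionary
(`IsDualPair.natCard_invariants`, §1 p. 60) for the twisted pair `(X^{τ_n}, S, ψ + n)`, read back on `X` by §1.
[cite: GreenbergLNM1716, §1 p. 60] -/
theorem natCard_torsionBy_X_add_C_eq (h : IsDualPair p ψ toDual) {n : ℕ} (hn : p ∣ n) :
    Nat.card (Submodule.torsionBy (IwasawaAlgebra p) X (PowerSeries.X + PowerSeries.C ((n : ℕ) : ℤ_[p]))) =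
      Nat.card (EndCoinvariants (ψ + (n : AddMonoid.End S))) := by
  rw [← natCard_invariants_twisted (norm_natCast_lt_one_of_dvd hn), (isDualPair_twisted h hn).natCard_invariants]

/-- **Lemma 4.2 (i) at the twist: `S[ψ + n]` finite ⇒ `S/(ψ + n)S` finite** (`X` finitely generated torsion,
`p ∣ n`): the tree's `IsDualPair.finite_endCoinvariants_of_finite` for the twisted pair, whose module
`X^{τ_n}` is again finitely generated torsion (`moduleFinite_twisted`, `isTorsion_twisted`).
[cite: GreenbergLNM1716, §4 Lemma 4.2] -/
theorem finite_endCoinvariants_add_natCast_of_finite (h : IsDualPair p ψ toDual)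
    [Module.Finite (IwasawaAlgebra p) X] (hX : Module.IsTorsion (IwasawaAlgebra p) X) {n : ℕ} (hn : p ∣ n)
    (hfin : Finite (endInvariants (ψ + (n : AddMonoid.End S)))) :
    Finite (EndCoinvariants (ψ + (n : AddMonoid.End S))) := by
  haveI := moduleFinite_twisted (norm_natCast_lt_one_of_dvd hn) (X := X)
  exact (isDualPair_twisted h hn).finite_endCoinvariants_of_finite
    (isTorsion_twisted (norm_natCast_lt_one_of_dvd hn) hX) hfin

/-- **`S[ψ + n]` finite ⇒ `X[T + n]` finite** (`X` f.g. torsion, `p ∣ n`): Lemma 4.2 (i) at the twist and the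
dictionary `#X[T + n] = #S/(ψ + n)S`. [cite: GreenbergLNM1716, §4 Lemma 4.2] -/
theorem finite_torsionBy_X_add_C_of_finite (h : IsDualPair p ψ toDual)
    [Module.Finite (IwasawaAlgebra p) X] (hX : Module.IsTorsion (IwasawaAlgebra p) X) {n : ℕ} (hn : p ∣ n)
    (hfin : Finite (endInvariants (ψ + (n : AddMonoid.End S)))) :
    Finite (Submodule.torsionBy (IwasawaAlgebra p) X (PowerSeries.X + PowerSeries.C ((n : ℕ) : ℤ_[p]))) := by
  haveI := finite_endCoinvariants_add_natCast_of_finite h hX hn hfin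
  exact Nat.finite_of_card_ne_zero (by rw [natCard_torsionBy_X_add_C_eq h hn]; exact Nat.card_pos.ne')

/-! ### §3 No finite submodule ⇒ the twisted coinvariants vanish (K67-NF shape) -/

/-- **★ No non-zero finite `Λ`-submodule ⇒ `S/(ψ + n)S = 0`.**  For a dual pair `(X, S, ψ)` with `X` finitely
generated torsion WITHOUT non-zero finite `Λ`-submodules, and `p ∣ n`: if `S[ψ + n]` is finite then the twisted
coinvariants `S/(ψ + n)S` are TRIVIAL.  Proof: `X[T + n]` is finite (§2), a `Λ`-submodule, hence `⊥` by the
hypothesis (Greenberg p. 124; tree `torsionBy_eq_bot_of_forall_finite_eq_bot`), so `#S/(ψ + n)S = #X[T + n] = 1`.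
At `p = n = 2`, `ψ = conj_γ − 1` on `Sel♭(E/ℚ_∞)` this is K67-NF `FlatBlindNoCotorsionAtTwo` from the Kim-shape
statement «`X♭` has no non-zero finite `Λ`-submodule».
[cite: GreenbergLNM1716, §4 p. 124] [cite: BDKim2013, Thm. 3.14 (shape only, odd p)] -/
theorem subsingleton_endCoinvariants_add_natCast_of_forall_finite_eq_bot (h : IsDualPair p ψ toDual)
    [Module.Finite (IwasawaAlgebra p) X] (hX : Module.IsTorsion (IwasawaAlgebra p) X)
    (hNF : ∀ N : Submodule (IwasawaAlgebra p) X, Finite N → N = ⊥) {n : ℕ} (hn : p ∣ n)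
    (hfin : Finite (endInvariants (ψ + (n : AddMonoid.End S)))) :
    Subsingleton (EndCoinvariants (ψ + (n : AddMonoid.End S))) := by
  have hbot := hNF _ (finite_torsionBy_X_add_C_of_finite h hX hn hfin)
  have hcard : Nat.card (EndCoinvariants (ψ + (n : AddMonoid.End S))) = 1 := by
    rw [← natCard_torsionBy_X_add_C_eq h hn, hbot]
    exact Nat.card_unique
  exact (Nat.card_eq_one_iff_unique.mp hcard).1

/-- The same with the conclusion as a cardinality: `#S/(ψ + n)S = 1`. [cite: GreenbergLNM1716, §4 p. 124] -/
theorem natCard_endCoinvariants_add_natCast_eq_one_of_forall_finite_eq_bot (h : IsDualPair p ψ toDual)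
    [Module.Finite (IwasawaAlgebra p) X] (hX : Module.IsTorsion (IwasawaAlgebra p) X)
    (hNF : ∀ N : Submodule (IwasawaAlgebra p) X, Finite N → N = ⊥) {n : ℕ} (hn : p ∣ n)
    (hfin : Finite (endInvariants (ψ + (n : AddMonoid.End S)))) :
    Nat.card (EndCoinvariants (ψ + (n : AddMonoid.End S))) = 1 := by
  haveI := subsingleton_endCoinvariants_add_natCast_of_forall_finite_eq_bot h hX hNF hn hfin
  exact Nat.card_of_subsingleton 0

/-! ### §4 The converse (hypothesis-free) and the equivalence -/

/-- **`S/(ψ + n)S = 0` ⇒ `X[T + n] = 0`** (`p ∣ n`; no finiteness or torsion hypothesis): `#X[T + n] = #S/(ψ + n)S = 1`.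
[cite: GreenbergLNM1716, §4 proof of Prop. 4.14 (p. 105)] -/
theorem torsionBy_X_add_C_eq_bot_of_subsingleton (h : IsDualPair p ψ toDual) {n : ℕ} (hn : p ∣ n)
    (hS : Subsingleton (EndCoinvariants (ψ + (n : AddMonoid.End S)))) :
    Submodule.torsionBy (IwasawaAlgebra p) X (PowerSeries.X + PowerSeries.C ((n : ℕ) : ℤ_[p])) = ⊥ := by
  have hcard : Nat.card
      (Submodule.torsionBy (IwasawaAlgebra p) X (PowerSeries.X + PowerSeries.C ((n : ℕ) : ℤ_[p]))) = 1 := by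
    rw [natCard_torsionBy_X_add_C_eq h hn]
    exact Nat.card_of_subsingleton 0
  obtain ⟨hsub, -⟩ := Nat.card_eq_one_iff_unique.mp hcard
  rw [Submodule.eq_bot_iff]
  intro x hx
  exact congrArg Subtype.val (Subsingleton.elim (⟨x, hx⟩ : Submodule.torsionBy (IwasawaAlgebra p) X _)
    ⟨0, Submodule.zero_mem _⟩)

/-- **Twisted coinvariants trivial ⇒ no non-zero finite `Λ`-submodule** (`p ∣ n`; Greenberg's last step in the
proof of Prop. 4.14, p. 105, and p. 117: `X[T + n] = 0` with `T + n ∈ 𝔪_Λ` excludes finite submodules by Nakayama;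
tree `forall_finite_eq_bot_of_torsionBy_eq_bot`).  The `ψ − c`-surjective form is
`TwistedCoinvariants.forall_finite_eq_bot_of_sub_nsmul_surjective` (cell bsd-potss).
[cite: GreenbergLNM1716, §4 proof of Prop. 4.14 (p. 105), p. 117] -/
theorem forall_finite_eq_bot_of_subsingleton_endCoinvariants_add_natCast (h : IsDualPair p ψ toDual)
    {n : ℕ} (hn : p ∣ n) (hS : Subsingleton (EndCoinvariants (ψ + (n : AddMonoid.End S)))) :
    ∀ N : Submodule (IwasawaAlgebra p) X, Finite N → N = ⊥ :=
  forall_finite_eq_bot_of_torsionBy_eq_bot p (X_add_C_mem_maximalIdeal (norm_natCast_lt_one_of_dvd hn))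
    (torsionBy_X_add_C_eq_bot_of_subsingleton h hn hS)

/-- **GIVEN `S[ψ + n]` finite: «`X` has no non-zero finite `Λ`-submodule» ⟺ «`S/(ψ + n)S = 0`»** (`X` f.g.
torsion, `p ∣ n`).  At `p = n = 2` on the ♭ datum: given `Sel♭_∞[γ+1]` finite (K67-CD), NF♭ ⟺ K67-NF.
[cite: GreenbergLNM1716, §4 pp. 105, 124] -/
theorem forall_finite_eq_bot_iff_subsingleton_endCoinvariants_add_natCast (h : IsDualPair p ψ toDual)
    [Module.Finite (IwasawaAlgebra p) X] (hX : Module.IsTorsion (IwasawaAlgebra p) X) {n : ℕ} (hn : p ∣ n)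
    (hfin : Finite (endInvariants (ψ + (n : AddMonoid.End S)))) :
    (∀ N : Submodule (IwasawaAlgebra p) X, Finite N → N = ⊥) ↔
      Subsingleton (EndCoinvariants (ψ + (n : AddMonoid.End S))) :=
  ⟨fun hNF => subsingleton_endCoinvariants_add_natCast_of_forall_finite_eq_bot h hX hNF hn hfin,
    fun hS => forall_finite_eq_bot_of_subsingleton_endCoinvariants_add_natCast h hn hS⟩

/-! ### §5 Without the torsion hypothesis: AMBIENT duals of positive `Λ`-rank (appended, GEN 57 (1b))

For an ambient `conj_γ`-stable `H ⊇ Sel` (Greenberg p. 119: `H = H¹(F_Σ/F_∞, E[p^∞])`, dual `Y` of `Λ`-rank `[F:ℚ]`,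
NOT torsion) Lemma 4.2 (i) is unavailable, and finiteness is read directly on the side one needs — (b) «`Y[T+n]`
finite», equivalently «`H/(ψ+n)H` finite» (`natCard_torsionBy_X_add_C_eq`).  With (a) «`Y` has no non-zero finite
`Λ`-submodule» (Greenberg Prop. 4.9 / 4.12 shape) this already gives `H/(ψ+n)H = 0`, i.e. `ψ + n` SURJECTIVE on `H`
(«DIV» at the twisted character) — the `ψ + n` twin of `SSFlatEC.forall_exists_apply_sub_eq_of_noFinite_of_finite`
(`Theorems/ByReductionTypeAtTwoSupersingularFlatDivAmbient.lean`, trivial character). -/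

/-- **`S/(ψ + n)S` finite ⇒ `X[T + n]` finite** (any dual pair, `p ∣ n`; no finite-generation or torsion hypothesis):
`#X[T + n] = #S/(ψ + n)S`. [cite: GreenbergLNM1716, §1 p. 60] -/
theorem finite_torsionBy_X_add_C_of_finite_endCoinvariants (h : IsDualPair p ψ toDual) {n : ℕ} (hn : p ∣ n)
    (hfin : Finite (EndCoinvariants (ψ + (n : AddMonoid.End S)))) :
    Finite (Submodule.torsionBy (IwasawaAlgebra p) X (PowerSeries.X + PowerSeries.C ((n : ℕ) : ℤ_[p]))) :=
  Nat.finite_of_card_ne_zero (by rw [natCard_torsionBy_X_add_C_eq h hn]; exact Nat.card_pos.ne')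

/-- **`X[T + n]` finite ⇒ `S/(ψ + n)S` finite** (any dual pair, `p ∣ n`). [cite: GreenbergLNM1716, §1 p. 60] -/
theorem finite_endCoinvariants_of_finite_torsionBy_X_add_C (h : IsDualPair p ψ toDual) {n : ℕ} (hn : p ∣ n)
    (hfin : Finite (Submodule.torsionBy (IwasawaAlgebra p) X (PowerSeries.X + PowerSeries.C ((n : ℕ) : ℤ_[p])))) :
    Finite (EndCoinvariants (ψ + (n : AddMonoid.End S))) :=
  Nat.finite_of_card_ne_zero (by rw [← natCard_torsionBy_X_add_C_eq h hn]; exact Nat.card_pos.ne')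

/-- **★ (a) ∧ (b) ⇒ `S/(ψ + n)S = 0`, torsion-free form**: for ANY dual pair `(X, S, ψ)` (`X` of any rank, not
necessarily finitely generated) such that `X` has no non-zero finite `Λ`-submodule, and `p ∣ n`: if `S/(ψ + n)S` is
finite it is TRIVIAL (`X[T + n]` is then a finite `Λ`-submodule, hence `⊥`, and `#S/(ψ + n)S = #X[T + n] = 1`).
Greenberg's p. 119 argument («(a) no proper `Λ`-submodule of finite index ∧ (b) `H_Γ` finite ⇒ `H_Γ = 0`») at the
twisted character. [cite: GreenbergLNM1716, §4 p. 119, p. 124] -/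
theorem subsingleton_endCoinvariants_add_natCast_of_forall_finite_eq_bot_of_finite (h : IsDualPair p ψ toDual)
    (hNF : ∀ N : Submodule (IwasawaAlgebra p) X, Finite N → N = ⊥) {n : ℕ} (hn : p ∣ n)
    (hfin : Finite (EndCoinvariants (ψ + (n : AddMonoid.End S)))) :
    Subsingleton (EndCoinvariants (ψ + (n : AddMonoid.End S))) := by
  have hbot := hNF _ (finite_torsionBy_X_add_C_of_finite_endCoinvariants h hn hfin)
  have hcard : Nat.card (EndCoinvariants (ψ + (n : AddMonoid.End S))) = 1 := by
    rw [← natCard_torsionBy_X_add_C_eq h hn, hbot]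
    exact Nat.card_unique
  exact (Nat.card_eq_one_iff_unique.mp hcard).1

/-- The same with (b) read on `X`: (a) ∧ «`X[T + n]` finite» ⇒ `S/(ψ + n)S = 0`.
[cite: GreenbergLNM1716, §4 p. 119, p. 124] -/
theorem subsingleton_endCoinvariants_add_natCast_of_forall_finite_eq_bot_of_finite_torsionBy
    (h : IsDualPair p ψ toDual) (hNF : ∀ N : Submodule (IwasawaAlgebra p) X, Finite N → N = ⊥) {n : ℕ}
    (hn : p ∣ n)
    (hfin : Finite (Submodule.torsionBy (IwasawaAlgebra p) X (PowerSeries.X + PowerSeries.C ((n : ℕ) : ℤ_[p])))) :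
    Subsingleton (EndCoinvariants (ψ + (n : AddMonoid.End S))) :=
  subsingleton_endCoinvariants_add_natCast_of_forall_finite_eq_bot_of_finite h hNF hn
    (finite_endCoinvariants_of_finite_torsionBy_X_add_C h hn hfin)

/-- **Surjectivity reading («DIV» at the twisted character)**: (a) ∧ (b) ⇒ every `s ∈ S` is `ψ t + n • t` for some
`t` (for `ψ = conj_γ − 1`, `n = 2`: `s = conj_γ t + t`). [cite: GreenbergLNM1716, §4 p. 119] -/
theorem forall_exists_apply_add_nsmul_eq_of_forall_finite_eq_bot_of_finite (h : IsDualPair p ψ toDual)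
    (hNF : ∀ N : Submodule (IwasawaAlgebra p) X, Finite N → N = ⊥) {n : ℕ} (hn : p ∣ n)
    (hfin : Finite (EndCoinvariants (ψ + (n : AddMonoid.End S)))) :
    ∀ s : S, ∃ t : S, ψ t + n • t = s := by
  haveI := subsingleton_endCoinvariants_add_natCast_of_forall_finite_eq_bot_of_finite h hNF hn hfin
  intro s
  obtain ⟨t, ht⟩ := (endCoinvariants_mk_eq_zero_iff (ψ + (n : AddMonoid.End S)) s).mp (Subsingleton.elim _ _)
  refine ⟨t, ?_⟩
  rw [← AddMonoid.End.natCast_apply]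
  exact ht

end DualPair

end IwasawaTranslation

end Summit.BirchSwinnertonDyer.BirchSwinnertonDyer.Theorems

end
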